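import Summits.BirchSwinnertonDyer.BirchSwinnertonDyer.Theorems.KimAtThreeTwoExponentPortOfZetaBody
import Summits.BirchSwinnertonDyer.BirchSwinnertonDyer.Theorems.KimAtThreeDeepUpperKolyvaginAdditiveThree
import Summits.BirchSwinnertonDyer.BirchSwinnertonDyer.Theorems.KimAtThreeDeepUpperAdditiveDefectOfPortE
import Literature.NumberTheory.EllipticCurves.LFunctionPrimeCoeff
import Literature.NumberTheory.EllipticCurves.RootNumberTwistProofs
import HarnessLib

/-!
# Route `KimAtThreeKolyvagin` (rung W2), crux `DeepUpperAtThreeOffKatoStratum` (item 19562), stub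
# `stub_additiveDefect`: SINGLE-DEPTH Kato–Kurihara witnesses on EVERY ADDITIVE row at `3` —
# `E(ℚ₃)[3] ≠ 0` ALLOWED — from Kato's `ZetaBody`, the `t`-free THEOREM D-u and the two-exponent value law

Cell `bsd-addord`, seat `bsd-addord-w2-acc1` gen 2 (PROGRAMME PART 1b, ACCEL-LIST l.753 row (1): «lattice-index
bookkeeping: v₃(c₃), #E(ℚ₃)[3], 3 ∣ Manin enter the defect d»), `--supports` stmt-BirchSwinnertonDyer-19562
(owner w2-c5 assembles).  TOOL / END THEOREMS WITH DISPLAYED HYPOTHESES: no definition, no named fact, no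
instance, no `sorry`; Kato's `ZetaBody` enters as the hypothesis `hbody` (witnesses BOUND, never obtained);
nothing is asserted about any curve; nothing is booked; crux 19562 stays OPEN; BSD is not proved.

## Why this file (the third defect disjunct)

The registered stub `stub_additiveDefect` of 19562 has THREE disjuncts: `3 ∣ c₃` (Kodaira IV/IV*),
`#E(ℚ₃)[3] ≠ 1` (`t = 1`), `3 ∣ c_{D₀}`.  n1011's ★ PK-6₂ and seat acc6's two-exponent twin ★₂
(`KimAtThreeTwoExponentPortOfZetaBody`, PORT₂ at `t = 0`) both consume THEOREM D's certificate `ht0`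
(`E(ℚ₃)[3] = 0 ⟹ 𝓕_can,3 = ⊤`, Mazur–Rubin Lemma A.1): the `t = 1` rows are out of their reach.  But gen 1's
engine `KimAtThreeDeepUpperOffStratumPortEDeep.deepUpper_conclusion_of_port_e_deep` needs NO two-level (COMP)
clause and takes the depth shift of the data and the value exponent as FREE parameters, and the tree holds
the `ht0`-FREE THEOREM D on the additive rows: n1011-p11's D5b (b)/D6b (T-DER-BP: the place `3` paid by a
DEEPER derivative family — Kolyvagin primes of level `m + 1`, `k + 2 ≤ m`, Mazur–Rubin Prop. A.2 — since
`9·E(K)[3^∞] = 0` at an additive `3`), re-keyed WITHOUT the bad-place certificate `hbad` by seat w2-c3 gen 5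
(`KimAtThreeDeepUpperKolyvaginAdditiveThree.…_torsionCoeff_of_unramified`: every bad `w ≠ 3`, anomalous or not,
paid by the (C2) conjunct of `ZetaBody` = Kato (8.1.3), classes unramified as `T`-classes).  Composing it with
seat acc6's two-exponent value law (`KimAtThreeTwoExponentValueLaw`, clause (ii₂)
`3^t·Λ_{0,r}(y) ≡ s ⊗ 1 ⟹ 3^e·Λfin(loc κ₀) = s̄`) and gen 1's scaling lemma gives, on EVERY additive row and for
EVERY `t`, the deep-keyed one-exponent witness family that gen 1's `HPortDefectDeep` displays — with NO `ht0`,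
NO `hbad`, NO `3 ∤ c₃`, NO Manin, NO period hypothesis.  Bookkeeping of record (Kim 2026 Rem. 3.8 read at
`3`): `t = log₃ #E(ℚ₃)[3] ∈ {0, 1}` is the exponent of the value law and costs depth shift `2` in the data;
`e = v₃(c₃) + v₃(c_P)` sits on the `Λfin`-side of (ii₂) (local lattice `3^{v₃(c₃)−t}ℤ₃·ω_E`, Manin
`Ω(E) = |c_P|·Ω⁺_f`; consistent by r1's LEMMA SAT for `t ∈ {0,1}` because `e ≥ v₃(c₃)`) and is scaled into the
families (`κ ↦ 3^e • κ`).

## What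

* `hasAdditiveReductionAt_of_addv` — `Addv W 3` ⟹ additive reduction at the place of `𝓞 ℚ` over `3`
  (the `hadd` binder of D6b-u; Silverman AEC VII.5.1 trichotomy + the tree's `ℚ_v ≃ ℚ_[3]` bridges).
* ★ `exists_katoKuriharaWitnessAtTwoExp_of_zetaBody_additive` — at ONE depth `k`, for a `τ`-datum `D` whose
  primes are usable for Kato's system and Kolyvagin of level `k + 3`: a family `κ` with seat acc6's
  `KatoKuriharaWitnessAtTwoExp W k t e D v₃ P κ Λₖ κ` (clauses (0)/(I4)/(Λ)/(DICT3₂), `κ′ := κ`) ⟸ `hbody`, `hirr`,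
  additive at `3`, the (Λ)-clauses and (ii₂) at depth `k`, and the depth-`k` VALUE rows at exponent `t`.
  Proof: D6b-u with `m := k + 2` (`hur := hbody.2.1`) ⟶ (0), (I4); (DICT3₂) per level = acc6's
  `apply_localization_add_self_eq_toZModPow_of_derivativeFamily_twoExp` + `exists_unit_mul_apply_eq_of_add_self`.
* ★★ `deepWitnessFamily_of_zetaBody_addv` — the DEEP-KEYED ONE-EXPONENT WITNESS FAMILY on an additive row
  (gen 1's `HPortDefectDeep` instance at depth shift `2`, value exponent `t`): for every depth `k` and every
  `τ`-datum `Dk` canonical for `η` with primes in the class of depth `k + 2`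
  (`Dk.IsCanonicalTauDatumThreeAtWith W (k + 2) k η`), SOME `(κ, Λ, κ′)` with n1011's
  `KatoKuriharaWitnessAt W k t Dk v₃ P κ Λ κ′` ⟸ `hbody` at the conductor (`hN`), `hirr`, `Addv W 3`, the
  functionals `Λfin j` with (Λ)-clauses and (ii₂) at `(j, t, e)` for all `j`, `hcdA`, and the per-level VALUE
  ROWS at exponent `t` (the OUT of n1011-p02 `ValueRow.valueRow_of_zetaBody`, general `t`; displayed here,
  discharged in the companion file).  NO `ht0`, NO `hbad`.
References: [Kato2004Asterisque] (8.1.3) p. 180, §9.4 p. 188, Thm. 9.7 p. 189, Ex. 13.3; [Kim2022StructureSelmer]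
§2.2.2, §3.2.3, Thm. 3.6, Rem. 3.8, §3.3–§3.4.1, Thm. 3.13; [MazurRubin2004] Def. 3.1.3, Thm. 3.2.4, App. A
(Lemma A.1, Prop. A.2, Rem. A.5); [Rubin2000] Def. 4.4.4, Thm. 4.5.1; [Sakamoto2024] §2, Def. 4.1;
[Kim2025RefinedTNC] §4.2, §8.1.2; [SilvermanAEC2009] VII.5 Prop. 5.1; kim3 memo KIM3-PROOF §4.2 Lemma L/L′;
HOME/w2c3/W2C3-D7U-CHAIN-g5.md.
-/

set_option autoImplicit false
-- the Theorems namespace of a single-conjunct summit repeats the summit name by design (D-0017)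
set_option linter.dupNamespace false

noncomputable section

open scoped NumberField TensorProduct ContRepresentation Classical
open CategoryTheory Field Function Finset IsDedekindDomain NumberField WeierstrassCurve
open Rat.HeightOneSpectrum
open Literature.NumberTheory.GaloisRepresentations Literature.NumberTheory.GaloisCohomology
open Literature.NumberTheory.GaloisRepresentations.DiscreteGaloisModule
open Literature.NumberTheory.EllipticCurves Literature.NumberTheory.EllipticCurves.ModularForms
open Literature.NumberTheory.EllipticCurves.Rank1Residual
open Literature.NumberTheory.EllipticCurves.Kato2004
open Literature.NumberTheory.EllipticCurves.Kato2004.EulerSystemValues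
open Summit.BirchSwinnertonDyer.Rank1Residual.GaloisImage
open Summit.BirchSwinnertonDyer.Rank1Residual.GaloisImage.TorsionCoeff
open Summit.BirchSwinnertonDyer.BirchSwinnertonDyer.Theorems.KimAtThreeKolyvaginDefs
open Summit.BirchSwinnertonDyer.BirchSwinnertonDyer.Theorems.KimAtThreeTwoExponentValueLaw
open Summit.BirchSwinnertonDyer.BirchSwinnertonDyer.Theorems.KimAtThreeDeepUpperKolyvaginAdditiveThree
open Summit.BirchSwinnertonDyer.BirchSwinnertonDyer.Theorems.KimAtThreeDeepUpperAdditiveDefectOfPortE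

namespace Summit.BirchSwinnertonDyer.BirchSwinnertonDyer.Theorems.KimAtThreeDeepUpperDefectWitnessOfZetaBody

/-! ### §0 `Addv W 3` ⟹ additive reduction at the place of `𝓞 ℚ` over `3` -/

/-- **`Addv W 3` (neither good nor multiplicative at the prime `3`) gives additive reduction at every place `v`
of `𝓞 ℚ` over `3`** — local trichotomy (Silverman AEC VII.5 Prop. 5.1) and the tree's bridges
`hasGoodReductionAtPrime_iff_hasGoodReductionAt_ringOfIntegers` /
`hasMultiplicativeReductionAtPrime_iff_hasMultiplicativeReductionAt_ringOfIntegers` along `ℚ_v ≃ ℚ_[3]`; the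
`hadd` binder of n1011-p11's D6b / w2-c3's D6b-u. [cite: SilvermanAEC2009, VII.5 Prop. 5.1 (PDF p. 174)] -/
theorem hasAdditiveReductionAt_of_addv (W : WeierstrassCurve ℚ) [W.IsElliptic]
    (hadd : haveI : Fact (Nat.Prime 3) := ⟨Nat.prime_three⟩; Addv W 3)
    (v : HeightOneSpectrum (𝓞 ℚ)) (hv : ((primesEquiv v : Nat.Primes) : ℕ) = 3) :
    W.HasAdditiveReductionAt v := by
  haveI : Fact (Nat.Prime 3) := ⟨Nat.prime_three⟩
  have hv' : primesEquiv v = ⟨3, Nat.prime_three⟩ := Subtype.ext hv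
  rcases W.hasGoodReductionAt_or_hasMultiplicativeReductionAt_or_hasAdditiveReductionAt v with h | h | h
  · exfalso
    have h' := (WeierstrassCurve.hasGoodReductionAtPrime_iff_hasGoodReductionAt_ringOfIntegers v W).mpr h
    rw [hv'] at h'
    exact hadd.1 h'
  · exfalso
    have h' := (W.hasMultiplicativeReductionAtPrime_iff_hasMultiplicativeReductionAt_ringOfIntegers v).mpr h
    rw [hv'] at h'
    exact hadd.2 h'
  · exact h

variable (W : WeierstrassCurve ℚ) [W.IsElliptic] [W.IsGloballyMinimal]
  [ContinuousSMul ℤ_[3] (W.tateModule 3)] [Module.Free ℤ_[3] (W.tateModule 3)]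
  [Module.Finite ℤ_[3] (W.tateModule 3)]

/-- Local notation: `𝐃F⟦r, τ⟧ ℓ = Σ_{j<ℓ−1} j·σ_{χ_{m(0,r)}(τ_ℓ)}^j` on the level field `ℚ(ζ_{m(0,r)})`. -/
local notation3 (prettyPrint := false) "𝐃F⟦" r ", " τ "⟧" =>
  fun ℓ : HeightOneSpectrum (𝓞 ℚ) =>
  ∑ j ∈ Finset.range (((primesEquiv ℓ : Nat.Primes) : ℕ) - 1),
    (j : Module.End ℚ (CyclotomicField (cycLevel 3 0 r) ℚ)) *
      (sigma (cycLevel 3 0 r) (modNCyclotomicCharacter ℚ (cycLevel 3 0 r)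
          ((τ : HeightOneSpectrum (𝓞 ℚ) → absoluteGaloisGroup ℚ) ℓ)) :
        CyclotomicField (cycLevel 3 0 r) ℚ →ₐ[ℚ] CyclotomicField (cycLevel 3 0 r) ℚ).toLinearMap ^ j

/-- Local notation: the TWO-EXPONENT rider clause (ii₂) at depth `j`, torsion exponent `t`, defect exponent
`e`, place `v`, for the pair `(Λ, Λf)` — seat acc6's spelling (`KimAtThreeTwoExponentWitnessPair`). -/
local notation3 (prettyPrint := false) "RIDER₂⟦" W' ", " j ", " t' ", " e' ", " v' ", " Λ' ", " Λf "⟧" =>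
  ∀ (r : Finset (HeightOneSpectrum (𝓞 ℚ)))
    (Ψ : H1 (tateRep W' 3) (cycSubgroup 3 0 r) →+
      continuousCohomology 1
        (subgroupRep (WeierstrassCurve.torsionGaloisModule W' (((3 : ℕ) : ℤ) ^ j * ((3 : ℕ) : ℤ))).toTopRep
          (cycSubgroup 3 0 r))),
    (∀ (φ : contOneCocycles (subgroupRep (tateRep W' 3).toTopRep (cycSubgroup 3 0 r)))
        (ψ : contOneCocycles
          (subgroupRep (WeierstrassCurve.torsionGaloisModule W' (((3 : ℕ) : ℤ) ^ j * ((3 : ℕ) : ℤ))).toTopRep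
            (cycSubgroup 3 0 r))),
        (∀ g, ((ψ.1 g : geomTorsion W' (((3 : ℕ) : ℤ) ^ j * ((3 : ℕ) : ℤ))) : geomPoints W') =
          TateModule.proj 3 (j + 1) (φ.1 g)) →
        Ψ (oneCocycleClass _ φ) = oneCocycleClass _ ψ) →
    ∀ (y : H1 (tateRep W' 3) (cycSubgroup 3 0 r))
      (κ₀ : galoisCohomology (WeierstrassCurve.torsionGaloisModule W' (((3 : ℕ) : ℤ) ^ j * ((3 : ℕ) : ℤ))) 1)
      (s : ℤ_[3]),
      resSubgroup (WeierstrassCurve.torsionGaloisModule W' (((3 : ℕ) : ℤ) ^ j * ((3 : ℕ) : ℤ))).toTopRep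
          (cycSubgroup 3 0 r) 1 κ₀ = Ψ y →
      galoisCohomology.localization (WeierstrassCurve.torsionGaloisModule W' (((3 : ℕ) : ℤ) ^ j * ((3 : ℕ) : ℤ)))
          (Sum.inr v') 1 κ₀ ∈ propagatedSelmerStructure W' 3 j (Sum.inr v') →
      (∃ l ∈ cycIntLattice 3 (cycLevel 3 0 r),
          (((3 : ℕ) : ℤ_[3]) ^ t') • Λ' 0 r y - ((s : ℚ_[3]) ⊗ₜ[ℚ] (1 : CyclotomicField (cycLevel 3 0 r) ℚ)) =
            (((3 : ℕ) : ℤ_[3]) ^ (j + 1)) • (l : ℚ_[3] ⊗[ℚ] CyclotomicField (cycLevel 3 0 r) ℚ)) →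
      ((3 ^ e' : ℕ) : ZMod (3 ^ (j + 1))) *
        Λf (galoisCohomology.localization
          (WeierstrassCurve.torsionGaloisModule W' (((3 : ℕ) : ℤ) ^ j * ((3 : ℕ) : ℤ))) (Sum.inr v') 1 κ₀) =
        PadicInt.toZModPow (j + 1) s

/-! ### §1 ★ One depth: the two-exponent witness clauses on an ADDITIVE row (no `ht0`, no `hbad`) -/

set_option backward.isDefEq.respectTransparency false in
/-- **★ SINGLE-DEPTH two-exponent witnesses on an ADDITIVE row at `3`, any torsion exponent `t`.**  For
`W/ℚ` globally minimal, a parametrisation datum `P` (newform `P.f`), Kato's witnesses bound by `hbody`, `E[3]`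
irreducible, ADDITIVE reduction at the place over `3`, a depth `k`, the (Λ)-clauses `hΛk` and the two-exponent
rider clause (ii₂) `hfin₂k` at `(k, t, e)` for a functional `Λk` at `v₃ ∣ 3`, a `τ`-datum `D` for `E[3^{k+1}]`
with cyclotomic transverse conditions and canonical comparison maps for `η`, primes usable for Kato's system
(`hPr`) and Kolyvagin of level `k + 3` (`hKol`), and the depth-`k` VALUE rows at exponent `t`: a family `κ`
with `KatoKuriharaWitnessAtTwoExp W k t e D v₃ P κ Λk κ`.  Proof: w2-c3's D6b-u
`exists_isKolyvaginSystem_propagatedSelmerStructure_three_of_hasAdditiveReductionAt_torsionCoeff_of_unramified`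
with `m := k + 2`, `hur := hbody.2.1` (NO `E(ℚ₃)[3] = 0`, NO bad-place certificate) ⟶ (0), (I4) with
`κ′ = κ`; (Λ) displayed; (DICT3₂) per level by seat acc6's two-exponent value law.
[cite: MazurRubin2004, App. A Prop. A.2, Remark A.5 and Thm. 3.2.4] [cite: Kato2004Asterisque, (8.1.3) (p. 180), §9.4 (p. 188) and Thm. 9.7 (p. 189)]
[cite: Kim2022StructureSelmer, Thm. 3.13 and §2.2.2, §3.2.3, §3.3–§3.4.1] [cite: Rubin2000, Def. 4.4.4] -/
theorem exists_katoKuriharaWitnessAtTwoExp_of_zetaBody_additive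
    {N : ℕ} [NeZero N] (P : ModularParametrizationData W N)
    {ι : (n : ℕ) → (CyclotomicField n ℚ →+* ℂ)} {κK : ℝ}
    {Λ : ∀ (k' : ℕ) (r : Finset (HeightOneSpectrum (𝓞 ℚ))),
      H1 (tateRep W 3) (cycSubgroup 3 k' r) →ₗ[ℤ_[3]] ℚ_[3] ⊗[ℚ] CyclotomicField (cycLevel 3 k' r) ℚ}
    {c d a : ℤ} {A : ℕ}
    {z : ∀ (k' : ℕ) (r : (cyclotomicLevelsRat 3 (badPlaces c d A N)).Ideals),
      H1 (tateRep W 3) ((cyclotomicLevelsRat 3 (badPlaces c d A N)).level k' r.1)}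
    {x : ∀ (k' : ℕ) (r : (cyclotomicLevelsRat 3 (badPlaces c d A N)).Ideals),
      CyclotomicField (cycLevel 3 k' r.1) ℚ}
    (hbody : ZetaBody W 3 P.f ι κK Λ c d a A z x)
    (hirr : W.HasIrreducibleModPGaloisRep 3)
    (hadd : ∀ v : HeightOneSpectrum (𝓞 ℚ), ((primesEquiv v : Nat.Primes) : ℕ) = 3 →
      W.HasAdditiveReductionAt v)
    {k t e : ℕ} {v₃ : HeightOneSpectrum (𝓞 ℚ)} (hv₃ : ((3 : ℕ) : 𝓞 ℚ) ∈ v₃.asIdeal)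
    {Λk : galoisCohomology ((W.torsionGaloisModule (((3 : ℕ) : ℤ) ^ k * ((3 : ℕ) : ℤ))).toLocal
      (Sum.inr v₃)) 1 →+ ZMod (3 ^ (k + 1))}
    (hΛk : (∀ c : ZMod (3 ^ (k + 1)), ∃ x ∈ propagatedSelmerStructure W 3 k (Sum.inr v₃), Λk x = c) ∧
      (∀ x ∈ propagatedSelmerStructure W 3 k (Sum.inr v₃),
        Λk x = 0 ↔ x ∈ W.kummerSelmerStructure (((3 : ℕ) : ℤ) ^ k * ((3 : ℕ) : ℤ)) (Sum.inr v₃)))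
    (hfin₂k : RIDER₂⟦W, k, t, e, v₃, Λ, Λk⟧)
    (D : KolyvaginDatum (W.torsionGaloisModule (((3 : ℕ) : ℤ) ^ k * ((3 : ℕ) : ℤ))))
    (hT : D.transverse = cyclotomicTransverse (W.torsionGaloisModule (((3 : ℕ) : ℤ) ^ k * ((3 : ℕ) : ℤ))))
    {η : (q : HeightOneSpectrum (𝓞 ℚ)) → (ZMod (Ideal.absNorm q.asIdeal))ˣ}
    (hD : D.HasCanonicalComparison (3 ^ (k + 1)) η)
    (hPr : D.primes ⊆ (cyclotomicLevelsRat 3 (badPlaces c d A N)).primes)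
    (hKol : ∀ q ∈ D.primes, Kato.IsKolyvaginPrime W 3 (k + 2 + 1) ((primesEquiv q : Nat.Primes) : ℕ))
    -- the VALUE ROWS at depth `k`, exponent `t` (T-PK6-VAL's OUT, displayed)
    (hvalk : ∀ σ : HeightOneSpectrum (𝓞 ℚ) → absoluteGaloisGroup ℚ,
      (∀ q, σ q ∈ (adicCompletionPrime ℚ q).inertia (absoluteGaloisGroup ℚ)) →
      (∀ q, modNCyclotomicCharacter ℚ (Ideal.absNorm q.asIdeal) (σ q) = η q) →
      ∀ (r : Finset (HeightOneSpectrum (𝓞 ℚ))) (hr : (↑r : Set _) ⊆ D.primes),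
        ∃ (s : ℤ_[3]) (u : (ZMod (3 ^ (k + 1)))ˣ)
          (ψ : (ℓ : ℕ) → (ZMod ℓ)ˣ →* Multiplicative (ZMod (3 ^ (k + 1)))),
          (∀ q ∈ r, Function.Surjective (ψ (Ideal.absNorm q.asIdeal))) ∧
          (∃ l ∈ cycIntLattice 3 (cycLevel 3 0 r),
            (((3 : ℕ) : ℤ_[3]) ^ t) • ((1 : ℚ_[3]) ⊗ₜ[ℚ]
              ((r.noncommProd 𝐃F⟦r, σ⟧ (ZetaValue.pairwise_commute_fieldDeriv (cycLevel 3 0 r)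
                  (fun ℓ => modNCyclotomicCharacter ℚ (cycLevel 3 0 r) (σ ℓ))
                  (fun ℓ => ((primesEquiv ℓ : Nat.Primes) : ℕ) - 1) r))
                (x 0 ⟨r, fun _ hq => hPr (hr (Finset.mem_coe.2 hq))⟩ +
                  sigma (cycLevel 3 0 r) (-1) (x 0 ⟨r, fun _ hq => hPr (hr (Finset.mem_coe.2 hq))⟩)))) -
              ((s : ℚ_[3]) ⊗ₜ[ℚ] (1 : CyclotomicField (cycLevel 3 0 r) ℚ)) =
            (((3 : ℕ) : ℤ_[3]) ^ (k + 1)) • (l : ℚ_[3] ⊗[ℚ] CyclotomicField (cycLevel 3 0 r) ℚ)) ∧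
          haveI : NeZero (∏ q ∈ r, Ideal.absNorm q.asIdeal) :=
            ⟨Finset.prod_ne_zero_iff.2 fun q _ h => q.ne_bot (Ideal.absNorm_eq_zero_iff.1 h)⟩
          PadicInt.toZModPow (k + 1) s = (u : ZMod (3 ^ (k + 1))) *
            ((3 : ℕ) : ZMod (3 ^ (k + 1))) ^ t *
              kuriharaNumber P.f (3 ^ (k + 1)) (∏ q ∈ r, Ideal.absNorm q.asIdeal) ψ) :
    ∃ κf : Finset (HeightOneSpectrum (𝓞 ℚ)) →
        galoisCohomology (W.torsionGaloisModule (((3 : ℕ) : ℤ) ^ k * ((3 : ℕ) : ℤ))) 1,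
      KatoKuriharaWitnessAtTwoExp W k t e D v₃ P κf Λk κf := by
  letI := TorsionCoeff.torsionBy.padicIntModule 3 (k + 1) (WeierstrassCurve.geomPoints W)
  letI := TorsionCoeff.torsionBy.padicIntModule 3 (k + 2 + 1) (WeierstrassCurve.geomPoints W)
  have hv₃p : ((primesEquiv v₃ : Nat.Primes) : ℕ) = 3 := primesEquiv_eq_of_natCast_mem Nat.prime_three hv₃
  -- T-DER-BP's reduction `E[3^{k+2}·3] → E[3^k·3]`, `x ↦ 9x`
  obtain ⟨rd, hrd⟩ := exists_torsionReduction_three W k (k + 2)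
  -- THEOREM D-u on the additive row (w2-c3's D6b-u): depth `k` family from the depth-`k + 2` system
  obtain ⟨σ, Φ, comm, κf, hσI, hσχ, hΦ, hKS, -, hres⟩ :=
    exists_isKolyvaginSystem_propagatedSelmerStructure_three_of_hasAdditiveReductionAt_torsionCoeff_of_unramified
      W (badPlaces c d A N) hbody.1 (le_refl (k + 2)) rd hrd hirr hadd D hT hD hPr hKol hbody.2.1
  refine ⟨κf, fun l hl => hKS.mem_selmerGroup l hl,
    ⟨hKS, fun l _ => by rw [sub_self]; exact zero_mem _⟩, hΛk.1, hΛk.2, fun r hr => ?_⟩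
  -- (DICT3₂) at the level `r`: acc6's two-exponent value law on the value row of `(σ, r)`
  obtain ⟨s, u, ψ, hψ, hval, hw⟩ := hvalk σ hσI hσχ r hr
  have h2 := apply_localization_add_self_eq_toZModPow_of_derivativeFamily_twoExp W 3 P.f ι κK Λ c d a A
    z x hbody hfin₂k (tateModuleRed W 3 (W.continuous_galoisRepTate_holds 3) (k + 1))
    (AddSubgroup.inclusion (geomTorsion_pow_succ_eq W 3 k).le : _ →+ _) continuous_of_discreteTopology
    (fun _ _ => rfl) (fun _ => rfl) D hPr σ Φ comm κf hΦ hKS hres hv₃p r hr s hval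
  obtain ⟨u', hu'⟩ := exists_unit_mul_apply_eq_of_add_self 3 (by decide)
    (Λk.comp (galoisCohomology.localization
      (W.torsionGaloisModule (((3 : ℕ) : ℤ) ^ k * ((3 : ℕ) : ℤ))) (Sum.inr v₃) 1)) (κf r) u h2 hw
  exact ⟨u', ψ, hψ, hu'⟩

/-! ### §2 ★★ The deep-keyed ONE-exponent witness family on an additive row (gen 1's `HPortDefectDeep`
instance: depth shift `2`, value exponent `t`), NO `ht0`, NO `hbad` -/

set_option backward.isDefEq.respectTransparency false in
/-- **★★ THE DEEP-KEYED WITNESS FAMILY ON AN ADDITIVE ROW FROM KATO'S EULER SYSTEM.**  For `W/ℚ` globally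
minimal, ADDITIVE at `3` (`Addv W 3`; `E(ℚ₃)[3]` unrestricted), `E[3]` irreducible, a parametrisation datum `P`
at the conductor level (`hN`), Kato's witnesses bound by `hbody` for `P.f`, a place `v₃ ∣ 3`, functionals
`Λfin j` with the (Λ)-clauses `hΛ` and the two-exponent riders `hfin₂` at `(j, t, e)` for every depth `j`, the
side condition `hcdA` (no prime `≡ 1 (mod 3)` divides `2cdA`), and the per-level VALUE ROWS at exponent `t`
(`hvalue`, displayed): for EVERY depth `k` and EVERY `τ`-datum `Dk` for `E[3^{k+1}]` canonical for `η` with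
primes in the class of depth `k + 2` (n1011 (B6) With-guard `IsCanonicalTauDatumThreeAtWith W (k + 2) k η`),
witnesses `(3^e•κ, Λfin k, 3^e•κ)` with `KatoKuriharaWitnessAt W k t Dk v₃ P …` — EXACTLY the binder shape of
gen 1's `deepUpper_conclusion_of_port_e_deep` / `HPortDefectDeep` at `(2, t)`.  Proof: the guard gives
Kolyvagin primes of level `k + 3` (E1-deep) hence usable primes (`hcdA`, `hN`); §1; gen 1's scaling lemma
`katoKuriharaWitnessAt_smul_of_twoExponent`.  In print `t = log₃ #E(ℚ₃)[3]`, `e = v₃(c₃) + v₃(c_P)`.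
[cite: Kim2022StructureSelmer, Thm. 3.13, Rem. 3.8, §2.2.2 and §3.2.3] [cite: MazurRubin2004, App. A Prop. A.2 and Thm. 3.2.4]
[cite: Kato2004Asterisque, (8.1.3) (p. 180), §9.4 (p. 188), Thm. 9.7 (p. 189) and Ex. 13.3 (pp. 224–225)]
[cite: Sakamoto2024, §2 and Def. 4.1] [cite: Kim2025RefinedTNC, §4.2 and §8.1.2] -/
theorem deepWitnessFamily_of_zetaBody_addv
    {N : ℕ} [NeZero N] (P : ModularParametrizationData W N) (hN : N = W.conductorNorm ℤ)
    {ι : (n : ℕ) → (CyclotomicField n ℚ →+* ℂ)} {κK : ℝ}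
    {Λ : ∀ (k' : ℕ) (r : Finset (HeightOneSpectrum (𝓞 ℚ))),
      H1 (tateRep W 3) (cycSubgroup 3 k' r) →ₗ[ℤ_[3]] ℚ_[3] ⊗[ℚ] CyclotomicField (cycLevel 3 k' r) ℚ}
    {c d a : ℤ} {A : ℕ}
    {z : ∀ (k' : ℕ) (r : (cyclotomicLevelsRat 3 (badPlaces c d A N)).Ideals),
      H1 (tateRep W 3) ((cyclotomicLevelsRat 3 (badPlaces c d A N)).level k' r.1)}
    {x : ∀ (k' : ℕ) (r : (cyclotomicLevelsRat 3 (badPlaces c d A N)).Ideals),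
      CyclotomicField (cycLevel 3 k' r.1) ℚ}
    (hbody : ZetaBody W 3 P.f ι κK Λ c d a A z x)
    (hirr : W.HasIrreducibleModPGaloisRep 3)
    (hA3 : haveI : Fact (Nat.Prime 3) := ⟨Nat.prime_three⟩; Addv W 3)
    {t e : ℕ} {v₃ : HeightOneSpectrum (𝓞 ℚ)} (hv₃ : ((3 : ℕ) : 𝓞 ℚ) ∈ v₃.asIdeal)
    (Λfin : ∀ j : ℕ, galoisCohomology ((W.torsionGaloisModule (((3 : ℕ) : ℤ) ^ j * ((3 : ℕ) : ℤ))).toLocal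
      (Sum.inr v₃)) 1 →+ ZMod (3 ^ (j + 1)))
    (hΛ : ∀ j : ℕ,
      (∀ c : ZMod (3 ^ (j + 1)), ∃ x ∈ propagatedSelmerStructure W 3 j (Sum.inr v₃), Λfin j x = c) ∧
      (∀ x ∈ propagatedSelmerStructure W 3 j (Sum.inr v₃),
        Λfin j x = 0 ↔ x ∈ W.kummerSelmerStructure (((3 : ℕ) : ℤ) ^ j * ((3 : ℕ) : ℤ)) (Sum.inr v₃)))
    (hfin₂ : ∀ j : ℕ, RIDER₂⟦W, j, t, e, v₃, Λ, Λfin j⟧)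
    {η : (q : HeightOneSpectrum (𝓞 ℚ)) → (ZMod (Ideal.absNorm q.asIdeal))ˣ}
    -- the auxiliary datum avoids every prime `≡ 1 (mod 3)` (so every Kolyvagin prime is usable)
    (hcdA : ∀ q : ℕ, q.Prime → q ≡ 1 [MOD 3] → ¬ q ∣ 2 * c.natAbs * d.natAbs * A)
    -- the per-level VALUE ROWS at exponent `t` (T-PK6-VROW's OUT), displayed
    (hvalue : ∀ (j : ℕ) (σ : HeightOneSpectrum (𝓞 ℚ) → absoluteGaloisGroup ℚ),
      (∀ q, σ q ∈ (adicCompletionPrime ℚ q).inertia (absoluteGaloisGroup ℚ)) →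
      (∀ q, modNCyclotomicCharacter ℚ (Ideal.absNorm q.asIdeal) (σ q) = η q) →
      ∀ (r : Finset (HeightOneSpectrum (𝓞 ℚ)))
        (hr : ∀ q ∈ r, q ∈ (cyclotomicLevelsRat 3 (badPlaces c d A N)).primes),
        (∀ q ∈ r, Kato.IsKolyvaginPrime W 3 (j + 1) ((primesEquiv q : Nat.Primes) : ℕ)) →
        (∀ q ∈ r, Subgroup.zpowers (η q) = ⊤) →
        ∃ (s : ℤ_[3]) (u : (ZMod (3 ^ (j + 1)))ˣ)
          (ψ : (ℓ : ℕ) → (ZMod ℓ)ˣ →* Multiplicative (ZMod (3 ^ (j + 1)))),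
          (∀ q ∈ r, Function.Surjective (ψ (Ideal.absNorm q.asIdeal))) ∧
          (∃ l ∈ cycIntLattice 3 (cycLevel 3 0 r),
            (((3 : ℕ) : ℤ_[3]) ^ t) • ((1 : ℚ_[3]) ⊗ₜ[ℚ]
              ((r.noncommProd 𝐃F⟦r, σ⟧ (ZetaValue.pairwise_commute_fieldDeriv (cycLevel 3 0 r)
                  (fun ℓ => modNCyclotomicCharacter ℚ (cycLevel 3 0 r) (σ ℓ))
                  (fun ℓ => ((primesEquiv ℓ : Nat.Primes) : ℕ) - 1) r))
                (x 0 ⟨r, hr⟩ + sigma (cycLevel 3 0 r) (-1) (x 0 ⟨r, hr⟩)))) -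
              ((s : ℚ_[3]) ⊗ₜ[ℚ] (1 : CyclotomicField (cycLevel 3 0 r) ℚ)) =
            (((3 : ℕ) : ℤ_[3]) ^ (j + 1)) • (l : ℚ_[3] ⊗[ℚ] CyclotomicField (cycLevel 3 0 r) ℚ)) ∧
          haveI : NeZero (∏ q ∈ r, Ideal.absNorm q.asIdeal) :=
            ⟨Finset.prod_ne_zero_iff.2 fun q _ h => q.ne_bot (Ideal.absNorm_eq_zero_iff.1 h)⟩
          PadicInt.toZModPow (j + 1) s = (u : ZMod (3 ^ (j + 1))) *
            ((3 : ℕ) : ZMod (3 ^ (j + 1))) ^ t *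
              kuriharaNumber P.f (3 ^ (j + 1)) (∏ q ∈ r, Ideal.absNorm q.asIdeal) ψ) :
    ∀ (k : ℕ) (Dk : KolyvaginDatum (W.torsionGaloisModule (((3 : ℕ) : ℤ) ^ k * ((3 : ℕ) : ℤ)))),
      Dk.IsCanonicalTauDatumThreeAtWith W (k + 2) k η →
      ∃ (κ : Finset (HeightOneSpectrum (𝓞 ℚ)) →
            galoisCohomology (W.torsionGaloisModule (((3 : ℕ) : ℤ) ^ k * ((3 : ℕ) : ℤ))) 1)
        (Λ' : galoisCohomology ((W.torsionGaloisModule (((3 : ℕ) : ℤ) ^ k * ((3 : ℕ) : ℤ))).toLocal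
            (Sum.inr v₃)) 1 →+ ZMod (3 ^ (k + 1)))
        (κ' : Finset (HeightOneSpectrum (𝓞 ℚ)) →
            galoisCohomology (W.torsionGaloisModule (((3 : ℕ) : ℤ) ^ k * ((3 : ℕ) : ℤ))) 1),
        KatoKuriharaWitnessAt W k t Dk v₃ P κ Λ' κ' := by
  intro k Dk hDk
  haveI : Fact (Nat.Prime 3) := ⟨Nat.prime_three⟩
  -- the guard: transverse conditions, comparison maps for `η`, primes in the class of depth `k + 2`
  obtain ⟨hT, hC, S, τ, hS, hτμ, hτq, hP⟩ := hDk
  -- Kolyvagin primes of level `k + 3` (E1-deep on the class of depth `k + 2`) and of level `k + 1`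
  have hKol3 : ∀ q ∈ Dk.primes, Kato.IsKolyvaginPrime W 3 (k + 2 + 1) ((primesEquiv q : Nat.Primes) : ℕ) :=
    fun q hq => KolyvaginPrime.isKolyvaginPrime_of_mem_frobeniusClassPrimes_of_le W (le_refl (k + 2))
      (fun v hv => (hS v hv).1) hτμ hτq (hP hq)
  have hKol1 : ∀ q ∈ Dk.primes, Kato.IsKolyvaginPrime W 3 (k + 1) ((primesEquiv q : Nat.Primes) : ℕ) :=
    fun q hq => KolyvaginPrime.isKolyvaginPrime_of_mem_frobeniusClassPrimes_of_le W (Nat.le_add_right k 2)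
      (fun v hv => (hS v hv).1) hτμ hτq (hP hq)
  -- every Kolyvagin prime is a usable prime of Kato's system for `(c, d, A, N)`
  have hPr : Dk.primes ⊆ (cyclotomicLevelsRat 3 (badPlaces c d A N)).primes := by
    intro q hq
    have hK := hKol1 q hq
    have hℓ := hK.prime
    have h13 : ((primesEquiv q : Nat.Primes) : ℕ) ≡ 1 [MOD 3] :=
      hK.modEq_one.of_dvd (dvd_pow_self 3 (Nat.succ_ne_zero k))
    refine (mem_primes_cyclotomicLevelsRat_badPlaces_iff 3 c d A N q).2 ⟨fun hdvd => ?_, hK.ne⟩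
    rcases (Nat.Prime.dvd_mul hℓ).mp hdvd with h | h
    · exact hcdA _ hℓ h13 h
    · apply hK.not_dvd
      rw [← hN]
      exact dvd_mul_of_dvd_left h 3
  -- additive reduction at the place over `3`
  have hadd : ∀ v : HeightOneSpectrum (𝓞 ℚ), ((primesEquiv v : Nat.Primes) : ℕ) = 3 →
      W.HasAdditiveReductionAt v := fun v hv => hasAdditiveReductionAt_of_addv W hA3 v hv
  -- §1 at depth `k` on the value rows of the datum's levels
  obtain ⟨κf, hW⟩ := exists_katoKuriharaWitnessAtTwoExp_of_zetaBody_additive W P hbody hirr hadd hv₃ (hΛ k)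
    (hfin₂ k) Dk hT hC hPr hKol3
    (fun σ hI hχ r hr => hvalue k σ hI hχ r (fun q hq => hPr (hr (Finset.mem_coe.2 hq)))
      (fun q hq => hKol1 q (hr (Finset.mem_coe.2 hq)))
      (fun q hq => hC.zpowers_eq_top (hr (Finset.mem_coe.2 hq))))
  -- scale the families by `3^e` (gen 1): the two-exponent law is the one-exponent law of `3^e • κ`
  obtain ⟨h0, ⟨hKS, hbr⟩, hon, hker, hdict⟩ := hW
  refine ⟨_, Λfin k, _, katoKuriharaWitnessAt_smul_of_twoExponent W k e t Dk v₃ P κf (Λfin k) κf h0 hKS hbr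
    hon hker fun l hl => ?_⟩
  obtain ⟨u, ψ, hψ, hL⟩ := hdict l hl
  refine ⟨u, ψ, hψ, ?_⟩
  push_cast at hL ⊢
  exact hL

end Summit.BirchSwinnertonDyer.BirchSwinnertonDyer.Theorems.KimAtThreeDeepUpperDefectWitnessOfZetaBody

end
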